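import Literature.RingTheory.FormalGroups.PadicLogTypeSeriesFrobenius
import HarnessLib

/-!
# The exact Dieudonné–Honda relation `φ²Λ − a·φΛ + p·Λ = 0` on a `[p]`-division tower

Topic `Literature/RingTheory/FormalGroups`; namespace `Literature.RingTheory.FormalGroups.PadicLogSeries`. THEOREMS ONLY (no
definition, no named fact, no instance, no `sorry`). Sequel of `PadicLogTypeSeriesFrobenius` (★★★ `exists_evalₐ_frobenius_honda_eq`:
for a Frobenius lift `φ(y) = yᵖ + p h` at a `p`-nilpotent `y` of index `N` and `ℓ_b` of Honda type `p − aT + T²`,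
`R(Λ_N(y)) := φ²Λ − ι(a)φΛ + pΛ ≡ 0 (mod p^{N+1})` at every level of `B^_(p)`). Here the error is removed along a TOWER:

* §1 levelwise divisibility in `B^_(p)` is linear, scales with `p^i`, and — `B` a domain — `p^i` can be CANCELLED
  (`forall_exists_evalₐ_eq_of_pow_mul`: read one level higher);
* §2 ★★★★ `frobenius_honda_eq_zero_of_tower`: for a tower `x : ℕ → B` of `p`-nilpotent elements (indices `N n`, monotone) with
  Frobenius lifts and the `[p]`-COMPATIBILITY `Λ_{N(n+1)}(x n) = p · Λ_{N(n+1)}(x (n+1))` (the canonical lifts `ι[ũ⁽ⁿ⁾]` of the shifts of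
  a `[p]_G`-division sequence, via the additivity file `PadicLogTypeSeriesAdd`), **`R(Λ_{N 0}(x 0)) = 0`** EXACTLY:
  `p^{N n − N 0}·R(Λ₀) = R(Λ_{N n}(x 0)) = pⁿ·R(Λ_{N n}(x n)) ≡ 0 (mod p^{n + N n + 1})`, cancel, let `n → ∞`.

For the logarithm of a one-dimensional formal group of height `2` over `ℤ_p` (`a = a_p`, numerators from
`EllipticCurves/FormalLogHondaNumeratorsProofs`) and `B = A_max`, this is the statement that the periods `L = Λ(ι[ũ])`, `M := φL` of
every point of the universal cover satisfy `φ(L, M) = (L, M)·[[0, −p], [1, a_p]]`, whence `φD = pD` for the Legendre determinant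
`D = L·M′ − M·L′` — brick B4 of the φ-road to (K₂) of line `kato_lever` (crux K★ `stmt-BirchSwinnertonDyer-22226`,
memo `Lines/kato-lever-K2-phi-road.md`). Infrastructure only: BSD / K★ are not proved by any of this.

## References
* T. Honda, *On the theory of commutative formal groups*, J. Math. Soc. Japan 22 (1970), Thm. 2 (p. 223), §6.2. [Honda1970]
* P. Colmez, *Périodes p-adiques des variétés abéliennes*, Math. Ann. 292 (1992), §2. [Colmez1992PeriodesAbeliennes]
* L. Berger, *Représentations p-adiques et équations différentielles*, Invent. Math. 148 (2002), §1.2. [BergerLaurent2002]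
-/

noncomputable section

open Finset

namespace Literature.RingTheory.FormalGroups

namespace PadicLogSeries

open Literature.AlgebraicGeometry.Resolution

variable {p : ℕ} [hp : Fact p.Prime]

universe u

variable {B : Type u} [CommRing B] [IsDomain B] [CharZero B] (ι : ℤ_[p] →+* B) (b : ℕ → ℤ_[p])

/-! ## §1 Levelwise divisibility in `B^_(p)`: linearity and cancellation of powers of `p` -/

omit hp [IsDomain B] [CharZero B] in
/-- Divisibility by `p^j` at every level is preserved by sums. [cite: BergerLaurent2002, §1.2] -/
theorem forall_exists_evalₐ_add_eq {j : ℕ} {X Y : AdicCompletion (Ideal.span {(p : B)}) B}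
    (hX : ∀ n, ∃ w : B, AdicCompletion.evalₐ (Ideal.span {(p : B)}) n X = Ideal.Quotient.mk _ ((p : B) ^ j * w))
    (hY : ∀ n, ∃ w : B, AdicCompletion.evalₐ (Ideal.span {(p : B)}) n Y = Ideal.Quotient.mk _ ((p : B) ^ j * w)) (n : ℕ) :
    ∃ w : B, AdicCompletion.evalₐ (Ideal.span {(p : B)}) n (X + Y) = Ideal.Quotient.mk _ ((p : B) ^ j * w) := by
  obtain ⟨w, hw⟩ := hX n
  obtain ⟨w', hw'⟩ := hY n
  exact ⟨w + w', by rw [map_add, hw, hw', ← map_add, mul_add]⟩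

omit hp [IsDomain B] [CharZero B] in
/-- Divisibility by `p^j` at every level is preserved by scalars from `B`. [cite: BergerLaurent2002, §1.2] -/
theorem forall_exists_evalₐ_mul_eq {j : ℕ} {X : AdicCompletion (Ideal.span {(p : B)}) B} (c : B)
    (hX : ∀ n, ∃ w : B, AdicCompletion.evalₐ (Ideal.span {(p : B)}) n X = Ideal.Quotient.mk _ ((p : B) ^ j * w)) (n : ℕ) :
    ∃ w : B, AdicCompletion.evalₐ (Ideal.span {(p : B)}) n (AdicCompletion.of (Ideal.span {(p : B)}) B c * X) =
      Ideal.Quotient.mk _ ((p : B) ^ j * w) := by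
  obtain ⟨w, hw⟩ := hX n
  exact ⟨c * w, by rw [map_mul, hw, AdicCompletion.evalₐ_of, ← map_mul, mul_left_comm]⟩

omit hp [IsDomain B] [CharZero B] in
/-- Multiplying by `p^i` raises levelwise divisibility from `p^j` to `p^{i+j}`. [cite: BergerLaurent2002, §1.2] -/
theorem forall_exists_evalₐ_pow_mul_eq {i j : ℕ} {X : AdicCompletion (Ideal.span {(p : B)}) B}
    (hX : ∀ n, ∃ w : B, AdicCompletion.evalₐ (Ideal.span {(p : B)}) n X = Ideal.Quotient.mk _ ((p : B) ^ j * w)) (n : ℕ) :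
    ∃ w : B, AdicCompletion.evalₐ (Ideal.span {(p : B)}) n (AdicCompletion.of (Ideal.span {(p : B)}) B ((p : B) ^ i) * X) =
      Ideal.Quotient.mk _ ((p : B) ^ (i + j) * w) := by
  obtain ⟨w, hw⟩ := hX n
  exact ⟨w, by rw [map_mul, hw, AdicCompletion.evalₐ_of, ← map_mul, ← mul_assoc, ← pow_add]⟩

/-- **Cancellation of `p^i` at every level** (`B` a domain): if `p^i · X` is divisible by `p^{i+j}` at every level, then `X` is divisible
by `p^j` at every level (read `X` at level `n + i` and cancel). [cite: BergerLaurent2002, §1.2] -/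
theorem forall_exists_evalₐ_eq_of_pow_mul {i j : ℕ} {X : AdicCompletion (Ideal.span {(p : B)}) B}
    (hX : ∀ n, ∃ w : B, AdicCompletion.evalₐ (Ideal.span {(p : B)}) n (AdicCompletion.of (Ideal.span {(p : B)}) B ((p : B) ^ i) * X) =
      Ideal.Quotient.mk _ ((p : B) ^ (i + j) * w)) (n : ℕ) :
    ∃ w : B, AdicCompletion.evalₐ (Ideal.span {(p : B)}) n X = Ideal.Quotient.mk _ ((p : B) ^ j * w) := by
  have hp0 : (p : B) ≠ 0 := Nat.cast_ne_zero.2 hp.out.ne_zero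
  obtain ⟨w, hw⟩ := hX (n + i)
  obtain ⟨x, hx⟩ := Ideal.Quotient.mk_surjective (AdicCompletion.evalₐ (Ideal.span {(p : B)}) (n + i) X)
  rw [map_mul, AdicCompletion.evalₐ_of, ← hx, ← map_mul, Ideal.Quotient.mk_eq_mk_iff_sub_mem,
    Ideal.span_singleton_pow, Ideal.mem_span_singleton'] at hw
  obtain ⟨c, hc⟩ := hw
  -- cancel `p^i`: `x - p^j w = p^n c`
  have hxw : x - (p : B) ^ j * w = (p : B) ^ n * c := by
    refine mul_left_cancel₀ (pow_ne_zero i hp0) ?_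
    rw [mul_sub, ← mul_assoc, ← pow_add, ← hc, pow_add]; ring
  refine ⟨w, ?_⟩
  rw [← factorPow_evalₐ (Ideal.span {(p : B)}) (Nat.le_add_right n i) X, ← hx, Ideal.Quotient.factorPow, Ideal.Quotient.factor_mk,
    Ideal.Quotient.mk_eq_mk_iff_sub_mem, hxw, Ideal.span_singleton_pow]
  exact Ideal.mul_mem_right _ _ (Ideal.mem_span_singleton_self _)

omit hp [IsDomain B] [CharZero B] in
/-- `of` is multiplicative (it is the structure map `B → B^_(p)`). [folklore] -/
private theorem of_mul' (c d : B) :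
    AdicCompletion.of (Ideal.span {(p : B)}) B (c * d) =
      AdicCompletion.of (Ideal.span {(p : B)}) B c * AdicCompletion.of (Ideal.span {(p : B)}) B d :=
  map_mul (algebraMap B (AdicCompletion (Ideal.span {(p : B)}) B)) c d

omit hp [IsDomain B] [CharZero B] in
/-- `of 1 = 1`. [folklore] -/
private theorem of_one' : AdicCompletion.of (Ideal.span {(p : B)}) B 1 = 1 :=
  map_one (algebraMap B (AdicCompletion (Ideal.span {(p : B)}) B))

omit hp [IsDomain B] [CharZero B] in
/-- `of (c^k) = (of c)^k`. [folklore] -/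
private theorem of_pow' (c : B) (k : ℕ) :
    AdicCompletion.of (Ideal.span {(p : B)}) B (c ^ k) = AdicCompletion.of (Ideal.span {(p : B)}) B c ^ k :=
  map_pow (algebraMap B (AdicCompletion (Ideal.span {(p : B)}) B)) c k

/-! ## §2 The Honda–Frobenius operator along a `[p]`-division tower and EXACT vanishing -/

section Frobenius

variable (φ : B →+* B)

/-- ★★★★ **Exact Dieudonné–Honda relation on a `[p]`-division tower.** Let `φ` be a ring endomorphism of `B` fixing `ι(ℤ_p)`,
`ℓ_b` of Honda type `p − aT + T²` (`he`), and `x : ℕ → B` a tower of `p`-nilpotent elements (`(x n)^{N n} = p · z n`, indices `N`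
monotone) with Frobenius lifts `φ(x n) = (x n)ᵖ + p·h n` and the `[p]`-COMPATIBILITY `Λ_{N(n+1)}(x n) = p · Λ_{N(n+1)}(x (n+1))`
(e.g. the canonical lifts `ι[ũ⁽ⁿ⁾]` of the shifts of a `[p]_G`-division sequence, `[p]_G x_{n+1} = x_n`, by additivity of `Λ`). Then for
`Λ₀ = Λ_{N 0}(x 0)`:  **`φ²Λ₀ − ι(a)·φΛ₀ + p·Λ₀ = 0`** in `B^_(p)` — the error `p^{N+1}` of `exists_evalₐ_frobenius_honda_eq` at depth `n`
becomes `p^{N(0)+1+n}` at depth `0`, for every `n`. [cite: Honda1970, Thm. 2 (p. 223) and §6.2] [cite: Colmez1992PeriodesAbeliennes, §2] -/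
theorem frobenius_honda_eq_zero_of_tower (hφι : φ.comp ι = ι) (a : ℤ_[p]) (e : ℕ → ℤ_[p])
    (he : ∀ m : ℕ, m ≠ 0 → (m : ℤ_[p]) * e m =
      b m - (if p ∣ m then a * b (m / p) else 0) + (if p ^ 2 ∣ m then (p : ℤ_[p]) * b (m / p ^ 2) else 0))
    (x z h : ℕ → B) (N : ℕ → ℕ) (hN0 : 1 ≤ N 0) (hNmono : Monotone N) (hxz : ∀ n, x n ^ N n = (p : B) * z n)
    (hφx : ∀ n, φ (x n) = x n ^ p + (p : B) * h n)
    (hdiv : ∀ n, logSum ι b (N (n + 1)) (x n) (z n * x n ^ (N (n + 1) - N n)) =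
      AdicCompletion.of (Ideal.span {(p : B)}) B (p : B) * logSum ι b (N (n + 1)) (x (n + 1)) (z (n + 1))) :
    adicCompletionMap _ _ φ (map_span_natCast_le_self φ)
        (adicCompletionMap _ _ φ (map_span_natCast_le_self φ) (logSum ι b (N 0) (x 0) (z 0))) -
      AdicCompletion.of (Ideal.span {(p : B)}) B (ι a) *
        adicCompletionMap _ _ φ (map_span_natCast_le_self φ) (logSum ι b (N 0) (x 0) (z 0)) +
      AdicCompletion.of (Ideal.span {(p : B)}) B (p : B) * logSum ι b (N 0) (x 0) (z 0) = 0 := by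
  -- notation: the Honda–Frobenius operator `R`
  set Φ := adicCompletionMap (Ideal.span {(p : B)}) (Ideal.span {(p : B)}) φ (map_span_natCast_le_self φ) with hΦ
  let R : AdicCompletion (Ideal.span {(p : B)}) B → AdicCompletion (Ideal.span {(p : B)}) B := fun X =>
    Φ (Φ X) - AdicCompletion.of (Ideal.span {(p : B)}) B (ι a) * Φ X + AdicCompletion.of (Ideal.span {(p : B)}) B (p : B) * X
  have hR_of_mul : ∀ (c : B) (X : AdicCompletion (Ideal.span {(p : B)}) B), φ c = c →
      R (AdicCompletion.of (Ideal.span {(p : B)}) B c * X) = AdicCompletion.of (Ideal.span {(p : B)}) B c * R X := by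
    intro c X hc
    simp only [R, map_mul, hΦ, adicCompletionMap_of, hc]
    ring
  have hφp : ∀ k : ℕ, φ ((p : B) ^ k) = (p : B) ^ k := fun k => by rw [map_pow, map_natCast]
  -- witnesses at a higher index
  have hNle : ∀ n, N 0 ≤ N n := fun n => hNmono (Nat.zero_le n)
  have hN1 : ∀ n, 1 ≤ N n := fun n => hN0.trans (hNle n)
  have hxz' : ∀ n k, N n ≤ k → x n ^ k = (p : B) * (z n * x n ^ (k - N n)) := fun n k hk => by
    rw [← mul_assoc, ← hxz n, ← pow_add, Nat.add_sub_cancel' hk]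
  -- Step 1: `Λ_{N n}(x 0) = p^n · Λ_{N n}(x n)` (iterate `hdiv`, moving indices with `logSum_eq_pow_mul_logSum`)
  have step1 : ∀ n, logSum ι b (N n) (x 0) (z 0 * x 0 ^ (N n - N 0)) =
      AdicCompletion.of (Ideal.span {(p : B)}) B ((p : B) ^ n) * logSum ι b (N n) (x n) (z n) := by
    intro n
    induction n with
    | zero => simp [of_one']
    | succ n ih =>
      have hNn : N n ≤ N (n + 1) := hNmono (Nat.le_succ n)
      -- raise the index of `ih` from `N n` to `N (n+1)`
      have e0 : logSum ι b (N (n + 1)) (x 0) (z 0 * x 0 ^ (N (n + 1) - N 0)) =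
          AdicCompletion.of (Ideal.span {(p : B)}) B ((p : B) ^ (N (n + 1) - N n)) *
            logSum ι b (N n) (x 0) (z 0 * x 0 ^ (N n - N 0)) :=
        logSum_eq_pow_mul_logSum ι b (hN1 n) hNn (hxz' 0 (N n) (hNle n)) (hxz' 0 (N (n + 1)) (hNle (n + 1)))
      have en : logSum ι b (N (n + 1)) (x n) (z n * x n ^ (N (n + 1) - N n)) =
          AdicCompletion.of (Ideal.span {(p : B)}) B ((p : B) ^ (N (n + 1) - N n)) * logSum ι b (N n) (x n) (z n) :=
        logSum_eq_pow_mul_logSum ι b (hN1 n) hNn (hxz n) (hxz' n (N (n + 1)) hNn)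
      rw [e0, ih, ← mul_assoc, ← of_mul', ← pow_add, add_comm, pow_add, of_mul', mul_assoc, ← en, hdiv n, ← mul_assoc,
        ← of_mul', ← pow_succ]
  -- Step 2: `R(Λ_{N n}(x n))` is divisible by `p^{N n + 1}` at every level (Frobenius annihilation at depth `n`)
  have step2 : ∀ n m, ∃ w : B, AdicCompletion.evalₐ (Ideal.span {(p : B)}) m (R (logSum ι b (N n) (x n) (z n))) =
      Ideal.Quotient.mk _ ((p : B) ^ (N n + 1) * w) := fun n m =>
    exists_evalₐ_frobenius_honda_eq ι b φ hφι (hN1 n) (hxz n) (hφx n) a e he m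
  -- Step 3: `p^{N n - N 0} · R(Λ₀) = R(Λ_{N n}(x 0)) = p^n · R(Λ_{N n}(x n))`, divisible by `p^{n + (N n + 1)}`
  have step3 : ∀ n m, ∃ w : B, AdicCompletion.evalₐ (Ideal.span {(p : B)}) m
      (AdicCompletion.of (Ideal.span {(p : B)}) B ((p : B) ^ (N n - N 0)) * R (logSum ι b (N 0) (x 0) (z 0))) =
      Ideal.Quotient.mk _ ((p : B) ^ (N n - N 0 + (n + 1 + N 0)) * w) := by
    intro n m
    have eidx : logSum ι b (N n) (x 0) (z 0 * x 0 ^ (N n - N 0)) =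
        AdicCompletion.of (Ideal.span {(p : B)}) B ((p : B) ^ (N n - N 0)) * logSum ι b (N 0) (x 0) (z 0) :=
      logSum_eq_pow_mul_logSum ι b hN0 (hNle n) (hxz 0) (hxz' 0 (N n) (hNle n))
    have hRR : AdicCompletion.of (Ideal.span {(p : B)}) B ((p : B) ^ (N n - N 0)) * R (logSum ι b (N 0) (x 0) (z 0)) =
        AdicCompletion.of (Ideal.span {(p : B)}) B ((p : B) ^ n) * R (logSum ι b (N n) (x n) (z n)) := by
      rw [← hR_of_mul _ _ (hφp _), ← eidx, step1 n, hR_of_mul _ _ (hφp _)]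
    rw [hRR]
    obtain ⟨w, hw⟩ := forall_exists_evalₐ_pow_mul_eq (i := n) (step2 n) m
    refine ⟨w, ?_⟩
    have hle := hNle n
    rw [hw, show n + (N n + 1) = N n - N 0 + (n + 1 + N 0) by omega]
  -- Step 4: cancel `p^{N n - N 0}` and let `n → ∞`
  refine eq_zero_of_forall_forall_evalₐ_eq fun j m => ?_
  obtain ⟨w, hw⟩ := forall_exists_evalₐ_eq_of_pow_mul (i := N j - N 0) (j := j + 1 + N 0) (step3 j) m
  refine ⟨(p : B) ^ (1 + N 0) * w, ?_⟩
  rw [hw, ← mul_assoc, ← pow_add, show j + 1 + N 0 = j + (1 + N 0) by omega]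

end Frobenius

end PadicLogSeries

end Literature.RingTheory.FormalGroups

end
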